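import Literature.NumberTheory.EllipticCurves.TateModule
import HarnessLib

/-!
# Discharges for `TateModule.lean`: the rank of the Tate module (Silverman, *AEC*, III.7.1(a))

D-0014 keeps `Literature/` sorry-free by stating cited results as named facts `def X : Prop`.
This sibling file of `Literature.NumberTheory.EllipticCurves.TateModule` proves the *reduction*
of the named fact `WeierstrassCurve.finrank_tateModule_eq_two` (Silverman, *AEC*, Prop. III.7.1(a):
`T_ℓ(E) ≅ ℤ_ℓ × ℤ_ℓ` for `ℓ ≠ char K`) to the named fact
`WeierstrassCurve.card_torsionPoints_eq_sq` (Silverman, *AEC*, Cor. III.6.4(b): `#E[m] = m²` for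
`m ≠ 0` in `K`), exactly as in the printed proof ("This follows immediately from (III.6.4b,c)",
*AEC* p. 88). The deep input III.6.4(b) (degrees of isogenies, `deg [m] = m²`, separability of
`[m]`) is not in Mathlib and stays a named fact; hence `finrank_tateModule_eq_two_holds` itself is
not yet asserted here.

## Contents (generic part, namespace `Literature.NumberTheory.EllipticCurves.TateModule`, any abelian group `A`, prime `p`)

* `pow_smul_proj_add`: `p ^ m • a_{n+m} = a_n` (iterated compatibility).
* `exists_smul_eq_of_card_torsionBy`: if `#A[p^k] = p^{2k}` for all `k`, then multiplication by
  `p` maps `A[p^{k+1}]` onto `A[p^k]` (counting: the kernel is `A[p]` of order `p²`).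
* `exists_proj_one_eq`: if multiplication by `p` maps `A[p^{k+1}]` onto `A[p^k]` for all `k`, every
  point of `A[p]` is the first component of an element of `T_p A` (recursive lifting).
* `exists_generators_of_card_torsionBy`: if `#A[p] = p²`, then `A[p]` is generated by two elements.
* `levelMap a b k : (ℤ/p^k)² → A[p^k]`, `(x, y) ↦ x a_k + y b_k`; it is surjective at every level as
  soon as `(a_1, b_1)` generates `A[p]` (`levelMap_surjective`), hence bijective under the
  cardinality hypothesis (`levelMap_bijective`).
* `compatSeqSubring p`: the ring of compatible sequences in `Π_k ℤ/p^k` and `toPadicInt`, its map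
  to `ℤ_[p]` (Mathlib `PadicInt.lift`), used to lift compatible coordinates.
* `pairMap a b : ℤ_[p] × ℤ_[p] →ₗ[ℤ_[p]] T_p A`, `(x, y) ↦ x • a + y • b`;
  `pairMap_bijective_of_levelMap_bijective`, `exists_pairMap_bijective`;
  `linearEquivProdOfCard : ℤ_[p] × ℤ_[p] ≃ₗ[ℤ_[p]] T_p A`;
  `finrank_eq_two_of_card_torsionBy`, `free_of_card_torsionBy`, `finite_of_card_torsionBy`, and the
  base changes `RationalTateModule.finrank_eq_two_of_card_torsionBy`,
  `RationalTateModule.finite_of_card_torsionBy`.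

## Elliptic-curve part (namespace `WeierstrassCurve`)

* `finrank_tateModule_eq_two_of_card_torsionPoints_eq_sq`:
  `card_torsionPoints_eq_sq W (AlgebraicClosure F) → finrank_tateModule_eq_two W p`
  (Silverman, *AEC*, III.7.1(a) from III.6.4(b)); likewise
  `finrank_rationalTateModule_eq_two_of_card_torsionPoints_eq_sq`, and `Module.Free`/`Module.Finite`
  for `T_p E`, `Module.Finite` for `V_p E` under the same hypothesis and `p ≠ char F`.

## References

* J. H. Silverman, *The Arithmetic of Elliptic Curves*, 2nd ed., GTM 106, Springer 2009,
  Cor. III.6.4(b) (p. 86–87), Prop. III.7.1(a) (p. 88). [SilvermanAEC2009]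
-/

noncomputable section

open scoped Classical
open scoped AddSubgroup TensorProduct

universe u

namespace Literature.NumberTheory.EllipticCurves

namespace TateModule

variable {A : Type u} [AddCommGroup A] {p : ℕ}

/-! ### Generalities on compatible sequences -/

/-- Iterated compatibility in `T_p A`: `p ^ m • a_{n+m} = a_n`. Silverman, *AEC*, III.§7. [folklore] -/
theorem pow_smul_proj_add (a : TateModule A p) (n m : ℕ) :
    p ^ m • proj p (n + m) a = proj p n a := by
  induction m with
  | zero => simp
  | succ m ih => rw [pow_succ, mul_smul, ← add_assoc, smul_proj_succ, ih]

/-- The `0`-th component of an element of `T_p A` vanishes (`A[p^0] = 0`). [folklore] -/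
@[simp]
theorem proj_zero (a : TateModule A p) : proj p 0 a = 0 := by
  simpa using pow_smul_proj 0 a

/-- For `Q ∈ A[n]` and `z : ℤ`, the scalar `(z mod n).val` acts on `Q` as `z` does. [folklore] -/
theorem val_intCast_smul_of_mem_torsionBy {n : ℕ} [NeZero n] {Q : A} (hQ : Q ∈ A[(n : ℕ)])
    (z : ℤ) : ((z : ZMod n)).val • Q = z • Q := by
  have hval : (((z : ZMod n)).val : ℤ) = z % n := ZMod.val_intCast z
  have hn : (n : ℤ) • Q = 0 := (Submodule.mem_torsionBy_iff _ _).mp hQ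
  rw [← natCast_zsmul, hval, Int.emod_def, sub_smul, mul_comm, mul_smul, hn, smul_zero, sub_zero]

/-- For `Q ∈ A[n]` and `x : ℕ`, the scalar `(x mod n).val` acts on `Q` as `x` does. [folklore] -/
theorem val_natCast_smul_of_mem_torsionBy {n : ℕ} {Q : A} (hQ : Q ∈ A[(n : ℕ)]) (x : ℕ) :
    ((x : ZMod n)).val • Q = x • Q := by
  rw [ZMod.val_natCast, ← AddSubgroup.torsionBy.mod_self_nsmul' x hQ]

/-- `A[p] ≤ A[p^(k+1)]`. [folklore] -/
theorem torsionBy_le_torsionBy_pow_succ (p k : ℕ) : A[(p : ℕ)] ≤ A[(p ^ (k + 1) : ℕ)] :=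
  Submodule.torsionBy_le_torsionBy_of_dvd _ _
    (Int.natCast_dvd_natCast.mpr (dvd_pow_self p (Nat.succ_ne_zero k)))

/-! ### Surjectivity of multiplication by `p` from cardinalities -/

section Card

variable [Fact p.Prime]

/-- If `#A[p^k] = p^{2k}` for all `k`, then multiplication by `p` maps `A[p^{k+1}]` onto `A[p^k]`:
its kernel on `A[p^{k+1}]` is `A[p]`, of order `p²`, so its image has `p^{2k}` elements.
Silverman, *AEC*, III.§7 ("the multiplication-by-`ℓ` maps are surjective"). [folklore] -/
theorem exists_smul_eq_of_card_torsionBy (hc : ∀ k : ℕ, Nat.card (A[(p ^ k : ℕ)]) = p ^ (2 * k))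
    (k : ℕ) {P : A} (hP : P ∈ A[(p ^ k : ℕ)]) :
    ∃ Q ∈ A[(p ^ (k + 1) : ℕ)], p • Q = P := by
  have hp : p.Prime := Fact.out
  haveI : Finite (A[(p ^ k : ℕ)]) :=
    Nat.finite_of_card_ne_zero (by rw [hc k]; exact pow_ne_zero _ hp.ne_zero)
  let ψ : A[(p ^ (k + 1) : ℕ)] →+ A := (nsmulAddMonoidHom p).comp (AddSubgroup.subtype _)
  have hψ : ∀ Q : A[(p ^ (k + 1) : ℕ)], ψ Q = p • (Q : A) := fun Q ↦ rfl
  have hrange : ψ.range ≤ A[(p ^ k : ℕ)] := by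
    rintro _ ⟨Q, rfl⟩
    rw [hψ, AddSubgroup.torsionBy.nsmul_iff, smul_smul, ← pow_succ]
    exact AddSubgroup.torsionBy.nsmul_iff.mp Q.2
  have hker : ψ.ker = (A[(p : ℕ)]).addSubgroupOf (A[(p ^ (k + 1) : ℕ)]) := by
    ext Q
    rw [AddMonoidHom.mem_ker, AddSubgroup.mem_addSubgroupOf, hψ, AddSubgroup.torsionBy.nsmul_iff]
  have hcardker : Nat.card ψ.ker = p ^ 2 := by
    rw [hker, Nat.card_congr
      (AddSubgroup.addSubgroupOfEquivOfLe (torsionBy_le_torsionBy_pow_succ p k)).toEquiv]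
    simpa using hc 1
  have hmul := ψ.ker.card_mul_index
  rw [AddSubgroup.index_ker, hcardker, hc (k + 1)] at hmul
  have hcr : Nat.card ψ.range = p ^ (2 * k) := by
    have h' : p ^ 2 * Nat.card ψ.range = p ^ 2 * p ^ (2 * k) := by rw [hmul]; ring
    exact Nat.eq_of_mul_eq_mul_left (pow_pos hp.pos 2) h'
  have heq : ψ.range = A[(p ^ k : ℕ)] :=
    AddSubgroup.eq_of_le_of_card_ge hrange (by rw [hcr, hc k])
  have hP' : P ∈ ψ.range := heq ▸ hP
  obtain ⟨Q, hQ⟩ := hP'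
  exact ⟨Q, Q.2, hQ⟩

end Card

/-! ### Lifting points of `A[p]` to `T_p A` -/

section Lift

variable (lift : ∀ k : ℕ, A[(p ^ k : ℕ)] → A[(p ^ (k + 1) : ℕ)])

/-- The recursive lift of `P ∈ A[p]` along chosen preimages `lift k : A[p^k] → A[p^{k+1}]` of
multiplication by `p`: `liftSeq lift P k ∈ A[p^{k+1}]`. [folklore] -/
def liftSeq (P : A[(p : ℕ)]) : (k : ℕ) → A[(p ^ (k + 1) : ℕ)]
  | 0 => ⟨P, by simp⟩
  | k + 1 => lift (k + 1) (liftSeq P k)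

/-- If multiplication by `p` maps `A[p^{k+1}]` onto `A[p^k]` for every `k`, then every `P ∈ A[p]`
is the first component of an element of `T_p A` (the projection `T_p A → A[p]` is surjective).
Silverman, *AEC*, III.§7. [folklore] -/
theorem exists_proj_one_eq
    (hs : ∀ (k : ℕ) (P : A), P ∈ A[(p ^ k : ℕ)] → ∃ Q ∈ A[(p ^ (k + 1) : ℕ)], p • Q = P)
    {P : A} (hP : P ∈ A[(p : ℕ)]) : ∃ a : TateModule A p, proj p 1 a = P := by
  choose lft hlft_mem hlft_eq using hs
  let lift : ∀ k : ℕ, A[(p ^ k : ℕ)] → A[(p ^ (k + 1) : ℕ)] :=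
    fun k Q ↦ ⟨lft k Q.1 Q.2, hlft_mem k Q.1 Q.2⟩
  have hlift : ∀ (k : ℕ) (Q : A[(p ^ k : ℕ)]), p • (lift k Q : A) = Q := fun k Q ↦ hlft_eq k Q.1 Q.2
  let s : ℕ → A := fun n ↦ match n with
    | 0 => 0
    | k + 1 => (liftSeq lift ⟨P, hP⟩ k : A)
  have hs0 : s 0 = 0 := rfl
  have hs1 : s 1 = P := rfl
  have hss : ∀ k, s (k + 1 + 1) = (lift (k + 1) (liftSeq lift ⟨P, hP⟩ k) : A) := fun k ↦ rfl
  have hmem : ∀ n, s n ∈ A[(p ^ n : ℕ)] := fun n ↦ match n with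
    | 0 => by simp [hs0]
    | k + 1 => (liftSeq lift ⟨P, hP⟩ k).2
  refine ⟨mk s (fun n ↦ AddSubgroup.torsionBy.nsmul_iff.mp (hmem n)) (fun n ↦ ?_), hs1⟩
  match n with
  | 0 => rw [hs1, hs0]; simpa using AddSubgroup.torsionBy.nsmul_iff.mp hP
  | k + 1 => rw [hss, hlift]

end Lift

/-! ### Two generators for `A[p]` -/

section Generators

variable [Fact p.Prime]

/-- A group `A[p]` of order `p²` (necessarily elementary abelian) is generated by two elements.
Silverman, *AEC*, III.6.4(b) (last step of the proof, "writing `E[m]` as a product of cyclic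
groups"). [folklore] -/
theorem exists_generators_of_card_torsionBy (hc1 : Nat.card (A[(p : ℕ)]) = p ^ 2) :
    ∃ P ∈ A[(p : ℕ)], ∃ Q ∈ A[(p : ℕ)], ∀ R ∈ A[(p : ℕ)], ∃ m n : ℤ, m • P + n • Q = R := by
  have hp : p.Prime := Fact.out
  haveI : Finite (A[(p : ℕ)]) :=
    Nat.finite_of_card_ne_zero (by rw [hc1]; exact pow_ne_zero _ hp.ne_zero)
  have h1 : 1 < Nat.card (A[(p : ℕ)]) := by rw [hc1]; exact Nat.one_lt_pow two_ne_zero hp.one_lt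
  haveI : Nontrivial (A[(p : ℕ)]) := Finite.one_lt_card_iff_nontrivial.mp h1
  obtain ⟨⟨P, hPmem⟩, hP0⟩ := exists_ne (0 : A[(p : ℕ)])
  have hP0' : P ≠ 0 := fun h ↦ hP0 (Subtype.ext h)
  have hordP : addOrderOf P = p :=
    addOrderOf_eq_prime (AddSubgroup.torsionBy.nsmul_iff.mp hPmem) hP0'
  have hzP : AddSubgroup.zmultiples P ≤ A[(p : ℕ)] := AddSubgroup.zmultiples_le.mpr hPmem
  have hcardzP : Nat.card (AddSubgroup.zmultiples P) = p := by rw [Nat.card_zmultiples, hordP]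
  have hlt : AddSubgroup.zmultiples P < A[(p : ℕ)] := by
    refine lt_of_le_of_ne hzP fun h ↦ ?_
    have h' : Nat.card (AddSubgroup.zmultiples P) = Nat.card (A[(p : ℕ)]) := by rw [h]
    rw [hcardzP, hc1] at h'
    exact absurd h' (by nlinarith [hp.one_lt])
  obtain ⟨Q, hQmem, hQnot⟩ := SetLike.exists_of_lt hlt
  refine ⟨P, hPmem, Q, hQmem, fun R hR ↦ ?_⟩
  set K := AddSubgroup.closure ({P, Q} : Set A) with hKdef
  have hK : K ≤ A[(p : ℕ)] := by
    rw [hKdef, AddSubgroup.closure_le]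
    rintro x hx
    rcases hx with rfl | rfl
    exacts [hPmem, hQmem]
  have hzK : AddSubgroup.zmultiples P ≤ K :=
    AddSubgroup.zmultiples_le.mpr (AddSubgroup.subset_closure (by simp))
  have hQK : Q ∈ K := AddSubgroup.subset_closure (by simp)
  haveI : Finite K := Finite.of_injective _ (AddSubgroup.inclusion_injective hK)
  have hdvd : Nat.card K ∣ p ^ 2 := hc1 ▸ AddSubgroup.card_dvd_of_le hK
  obtain ⟨i, hi, hKi⟩ := (Nat.dvd_prime_pow hp).mp hdvd
  have hpK : p ∣ Nat.card K := hcardzP ▸ AddSubgroup.card_dvd_of_le hzK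
  interval_cases i
  · rw [hKi, pow_zero, Nat.dvd_one] at hpK
    exact absurd hpK hp.one_lt.ne'
  · exfalso
    have hzKeq : AddSubgroup.zmultiples P = K :=
      AddSubgroup.eq_of_le_of_card_ge hzK (by rw [hKi, hcardzP, pow_one])
    exact hQnot (hzKeq ▸ hQK)
  · have hKeq : K = A[(p : ℕ)] := AddSubgroup.eq_of_le_of_card_ge hK (by rw [hKi, hc1])
    have hRK : R ∈ K := hKeq ▸ hR
    exact AddSubgroup.mem_closure_pair.mp hRK

end Generators

/-! ### The level maps `(ℤ/p^k)² → A[p^k]` attached to a pair `a, b ∈ T_p A` -/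

section Level

variable (a b : TateModule A p)

variable (p) in
/-- The level-`k` map of a pair `a, b ∈ T_p A`: `(ℤ/p^k)² → A[p^k]`, `(x, y) ↦ x • a_k + y • b_k`.
Silverman, *AEC*, III.§7. [folklore] -/
def levelMap (k : ℕ) (xy : ZMod (p ^ k) × ZMod (p ^ k)) : A[(p ^ k : ℕ)] :=
  ⟨xy.1.val • proj p k a + xy.2.val • proj p k b,
    add_mem (AddSubgroup.nsmul_mem _ (proj_mem_torsionBy k a) _)
      (AddSubgroup.nsmul_mem _ (proj_mem_torsionBy k b) _)⟩

/-- Unfolding `levelMap`. [folklore] -/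
@[simp]
theorem coe_levelMap (k : ℕ) (xy : ZMod (p ^ k) × ZMod (p ^ k)) :
    (levelMap p a b k xy : A) = xy.1.val • proj p k a + xy.2.val • proj p k b :=
  rfl

variable [Fact p.Prime]

/-- `levelMap` on integer representatives: `levelMap k (z, w) = z • a_k + w • b_k`. [folklore] -/
theorem coe_levelMap_intCast (k : ℕ) (z w : ℤ) :
    (levelMap p a b k ((z : ZMod (p ^ k)), (w : ZMod (p ^ k))) : A) =
      z • proj p k a + w • proj p k b := by
  haveI : NeZero (p ^ k) := ⟨pow_ne_zero _ (Fact.out : p.Prime).ne_zero⟩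
  rw [coe_levelMap, val_intCast_smul_of_mem_torsionBy (proj_mem_torsionBy k a),
    val_intCast_smul_of_mem_torsionBy (proj_mem_torsionBy k b)]

/-- Compatibility of the level maps: reducing the coefficients from level `n + d` to level `n`
corresponds to multiplying the value by `p ^ d`. [folklore] -/
theorem coe_levelMap_castHom (n d : ℕ) (h : n ≤ n + d) (xy : ZMod (p ^ (n + d)) × ZMod (p ^ (n + d))) :
    (levelMap p a b n (ZMod.castHom (pow_dvd_pow p h) _ xy.1, ZMod.castHom (pow_dvd_pow p h) _ xy.2) :
        A) = p ^ d • (levelMap p a b (n + d) xy : A) := by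
  haveI : NeZero (p ^ (n + d)) := ⟨pow_ne_zero _ (Fact.out : p.Prime).ne_zero⟩
  rw [coe_levelMap, coe_levelMap, ZMod.castHom_apply, ZMod.castHom_apply, ZMod.cast_eq_val,
    ZMod.cast_eq_val, val_natCast_smul_of_mem_torsionBy (proj_mem_torsionBy n a),
    val_natCast_smul_of_mem_torsionBy (proj_mem_torsionBy n b), ← pow_smul_proj_add a n d,
    ← pow_smul_proj_add b n d, smul_add, smul_comm (p ^ d) xy.1.val, smul_comm (p ^ d) xy.2.val]

/-- If `(a_1, b_1)` generates `A[p]`, then `(a_k, b_k)` generates `A[p^k]` for every `k`, i.e. the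
level maps are surjective. Induction on `k`: for `R ∈ A[p^{k+1}]`, `p • R = x a_k + y b_k =
p • (x a_{k+1} + y b_{k+1})`, so `R - (x a_{k+1} + y b_{k+1}) ∈ A[p]` is a combination of
`a_1 = p^k a_{k+1}` and `b_1 = p^k b_{k+1}`. Silverman, *AEC*, III.§7. [folklore] -/
theorem levelMap_surjective
    (hgen : ∀ R ∈ A[(p : ℕ)], ∃ m n : ℤ, m • proj p 1 a + n • proj p 1 b = R) (k : ℕ) :
    Function.Surjective (levelMap p a b k) := by
  induction k with
  | zero =>
    rintro ⟨R, hR⟩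
    refine ⟨(0, 0), Subtype.ext ?_⟩
    have hR0 : R = 0 := by simpa using AddSubgroup.torsionBy.nsmul_iff.mp hR
    simp [hR0]
  | succ k ih =>
    rintro ⟨R, hR⟩
    have hpR : p • R ∈ A[(p ^ k : ℕ)] := by
      rw [AddSubgroup.torsionBy.nsmul_iff, smul_smul, ← pow_succ]
      exact AddSubgroup.torsionBy.nsmul_iff.mp hR
    obtain ⟨⟨x, y⟩, hxy⟩ := ih ⟨p • R, hpR⟩
    have hxy' : (x.val : ℤ) • proj p k a + (y.val : ℤ) • proj p k b = p • R := by
      have := congrArg Subtype.val hxy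
      simpa only [coe_levelMap, natCast_zsmul] using this
    set S : A := (x.val : ℤ) • proj p (k + 1) a + (y.val : ℤ) • proj p (k + 1) b with hS
    have hpS : p • S = p • R := by
      rw [← hxy', hS, smul_add, smul_comm p (x.val : ℤ), smul_comm p (y.val : ℤ),
        smul_proj_succ, smul_proj_succ]
    have hRS : R - S ∈ A[(p : ℕ)] := by
      rw [AddSubgroup.torsionBy.nsmul_iff, smul_sub, hpS, sub_self]
    obtain ⟨m, n, hmn⟩ := hgen (R - S) hRS
    refine ⟨((((x.val : ℤ) + m * p ^ k : ℤ) : ZMod (p ^ (k + 1))),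
      (((y.val : ℤ) + n * p ^ k : ℤ) : ZMod (p ^ (k + 1)))), Subtype.ext ?_⟩
    rw [coe_levelMap_intCast]
    change _ = R
    have ha1 : proj p 1 a = (p ^ k : ℤ) • proj p (k + 1) a := by
      have h := pow_smul_proj_add a 1 k
      rw [add_comm] at h
      rw [← h, ← natCast_zsmul, Nat.cast_pow]
    have hb1 : proj p 1 b = (p ^ k : ℤ) • proj p (k + 1) b := by
      have h := pow_smul_proj_add b 1 k
      rw [add_comm] at h
      rw [← h, ← natCast_zsmul, Nat.cast_pow]
    rw [ha1, hb1, smul_smul, smul_smul] at hmn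
    have hR : R = S + (R - S) := by abel
    rw [hR, ← hmn, hS]
    module

/-- Under `#A[p^k] = p^{2k}`, surjective level maps are bijective: `(ℤ/p^k)² ≃ A[p^k]`.
Silverman, *AEC*, III.6.4(b). [folklore] -/
theorem levelMap_bijective (hc : ∀ k : ℕ, Nat.card (A[(p ^ k : ℕ)]) = p ^ (2 * k))
    (hgen : ∀ R ∈ A[(p : ℕ)], ∃ m n : ℤ, m • proj p 1 a + n • proj p 1 b = R) (k : ℕ) :
    Function.Bijective (levelMap p a b k) := by
  haveI : NeZero (p ^ k) := ⟨pow_ne_zero _ (Fact.out : p.Prime).ne_zero⟩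
  refine (levelMap_surjective a b hgen k).bijective_of_nat_card_le (le_of_eq ?_)
  rw [Nat.card_prod, Nat.card_zmod, hc k, two_mul, pow_add]

end Level

/-! ### Lifting compatible residues to `ℤ_[p]` -/

section CompatSeq

variable (p)

/-- The ring of compatible sequences `(s_k)_k ∈ Π_k ℤ/p^k` (`s_n mod p^m = s_m` for `m ≤ n`), i.e.
the inverse limit `lim← ℤ/p^k` as a subring of the product. [folklore] -/
def compatSeqSubring : Subring (∀ k : ℕ, ZMod (p ^ k)) where
  carrier := {s | ∀ (m n : ℕ) (h : m ≤ n), ZMod.castHom (pow_dvd_pow p h) (ZMod (p ^ m)) (s n) = s m}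
  mul_mem' {s t} hs ht m n h := by simp only [Pi.mul_apply, map_mul, hs m n h, ht m n h]
  one_mem' m n h := by simp only [Pi.one_apply, map_one]
  add_mem' {s t} hs ht m n h := by simp only [Pi.add_apply, map_add, hs m n h, ht m n h]
  zero_mem' m n h := by simp only [Pi.zero_apply, map_zero]
  neg_mem' {s} hs m n h := by simp only [Pi.neg_apply, map_neg, hs m n h]

/-- Membership in `compatSeqSubring p`. [folklore] -/
theorem mem_compatSeqSubring_iff {s : ∀ k : ℕ, ZMod (p ^ k)} :
    s ∈ compatSeqSubring p ↔
      ∀ (m n : ℕ) (h : m ≤ n), ZMod.castHom (pow_dvd_pow p h) (ZMod (p ^ m)) (s n) = s m :=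
  Iff.rfl

/-- The projections `compatSeqSubring p →+* ℤ/p^k`. [folklore] -/
def compatSeqProj (k : ℕ) : compatSeqSubring p →+* ZMod (p ^ k) :=
  (Pi.evalRingHom (fun k : ℕ ↦ ZMod (p ^ k)) k).comp (compatSeqSubring p).subtype

/-- The projections of `compatSeqSubring p` are compatible with reduction. [folklore] -/
theorem compatSeqProj_compat (k1 k2 : ℕ) (hk : k1 ≤ k2) :
    (ZMod.castHom (pow_dvd_pow p hk) (ZMod (p ^ k1))).comp (compatSeqProj p k2) =
      compatSeqProj p k1 :=
  RingHom.ext fun s ↦ s.2 k1 k2 hk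

variable [Fact p.Prime]

/-- The canonical map `lim← ℤ/p^k → ℤ_[p]` (Mathlib `PadicInt.lift`, universal property of `ℤ_[p]`
as a projective limit). [folklore] -/
def toPadicInt : compatSeqSubring p →+* ℤ_[p] :=
  PadicInt.lift (compatSeqProj_compat p)

/-- `toPadicInt` has the prescribed residues: `toPadicInt s mod p^k = s_k`
(Mathlib `PadicInt.lift_spec`). [folklore] -/
@[simp]
theorem toZModPow_toPadicInt (s : compatSeqSubring p) (k : ℕ) :
    PadicInt.toZModPow k (toPadicInt p s) = (s : ∀ k : ℕ, ZMod (p ^ k)) k := by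
  have := congrArg (fun f ↦ f s) (PadicInt.lift_spec (compatSeqProj_compat p) k)
  simpa [toPadicInt, compatSeqProj] using this

end CompatSeq

/-! ### `T_p A ≅ ℤ_p²` from `#A[p^k] = p^{2k}` -/

section Rank

variable [Fact p.Prime]

/-- The `ℤ_[p]`-linear map `ℤ_[p] × ℤ_[p] → T_p A`, `(x, y) ↦ x • a + y • b`, attached to a pair
`a, b ∈ T_p A`. Silverman, *AEC*, III.7.1(a). [folklore] -/
def pairMap (a b : TateModule A p) : ℤ_[p] × ℤ_[p] →ₗ[ℤ_[p]] TateModule A p :=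
  (LinearMap.toSpanSingleton ℤ_[p] _ a).coprod (LinearMap.toSpanSingleton ℤ_[p] _ b)

/-- Unfolding `pairMap`. [folklore] -/
@[simp]
theorem pairMap_apply (a b : TateModule A p) (xy : ℤ_[p] × ℤ_[p]) :
    pairMap a b xy = xy.1 • a + xy.2 • b := by
  simp [pairMap]

/-- Components of `pairMap a b (x, y)`: the level-`k` map at the residues `(x mod p^k, y mod p^k)`.
[folklore] -/
theorem proj_pairMap (a b : TateModule A p) (x y : ℤ_[p]) (k : ℕ) :
    proj p k (pairMap a b (x, y)) =
      (levelMap p a b k (PadicInt.toZModPow k x, PadicInt.toZModPow k y) : A) := by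
  rw [pairMap_apply, map_add, proj_smul, proj_smul, coe_levelMap]

/-- If all level maps of the pair `a, b` are bijective, then `pairMap a b : ℤ_p² → T_p A` is
bijective: injectivity because an element of `ℤ_[p]` with all residues `0` is `0`
(Mathlib `PadicInt.ext_of_toZModPow`), surjectivity by lifting the (compatible) level coordinates
of `t ∈ T_p A` to `ℤ_[p]` (`toPadicInt`). Silverman, *AEC*, III.7.1(a). [folklore] -/
theorem pairMap_bijective_of_levelMap_bijective (a b : TateModule A p)
    (hbij : ∀ k : ℕ, Function.Bijective (levelMap p a b k)) :
    Function.Bijective (pairMap a b) := by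
  constructor
  · -- injectivity
    rw [injective_iff_map_eq_zero]
    rintro ⟨x, y⟩ hxy
    have hk : ∀ k : ℕ, (PadicInt.toZModPow k x, PadicInt.toZModPow k y) = (0, 0) := fun k ↦ by
      apply (hbij k).1
      apply Subtype.ext
      rw [← proj_pairMap, hxy, map_zero, coe_levelMap]
      simp
    have hx : x = 0 := PadicInt.ext_of_toZModPow.mp fun k ↦ by
      rw [map_zero]; exact congrArg Prod.fst (hk k)
    have hy : y = 0 := PadicInt.ext_of_toZModPow.mp fun k ↦ by
      rw [map_zero]; exact congrArg Prod.snd (hk k)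
    rw [hx, hy, Prod.mk_zero_zero]
  · -- surjectivity
    intro t
    -- level coordinates of `t`
    let c : ∀ k : ℕ, ZMod (p ^ k) × ZMod (p ^ k) :=
      fun k ↦ Function.surjInv (hbij k).2 ⟨proj p k t, proj_mem_torsionBy k t⟩
    have hc : ∀ k, (levelMap p a b k (c k) : A) = proj p k t := fun k ↦
      congrArg Subtype.val (Function.surjInv_eq (hbij k).2 ⟨proj p k t, proj_mem_torsionBy k t⟩)
    -- compatibility of the coordinates
    have hcompat : ∀ (m n : ℕ) (h : m ≤ n),
        (ZMod.castHom (pow_dvd_pow p h) (ZMod (p ^ m)) (c n).1,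
          ZMod.castHom (pow_dvd_pow p h) (ZMod (p ^ m)) (c n).2) = c m := by
      intro m n h
      obtain ⟨d, rfl⟩ := Nat.exists_eq_add_of_le h
      apply (hbij m).1
      apply Subtype.ext
      rw [coe_levelMap_castHom a b m d h, hc, hc, pow_smul_proj_add]
    have hmem1 : (fun k ↦ (c k).1) ∈ compatSeqSubring p := fun m n h ↦
      congrArg Prod.fst (hcompat m n h)
    have hmem2 : (fun k ↦ (c k).2) ∈ compatSeqSubring p := fun m n h ↦
      congrArg Prod.snd (hcompat m n h)
    refine ⟨(toPadicInt p ⟨_, hmem1⟩, toPadicInt p ⟨_, hmem2⟩), TateModule.ext fun k ↦ ?_⟩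
    rw [proj_pairMap, toZModPow_toPadicInt, toZModPow_toPadicInt]
    exact hc k

/-- **Structure of the Tate module from the count of torsion points.** If `#A[p^k] = p^{2k}` for
every `k`, there is a pair `a, b ∈ T_p A` with `pairMap a b : ℤ_[p] × ℤ_[p] → T_p A` bijective.
This is the content of Silverman, *AEC*, Prop. III.7.1(a), given Cor. III.6.4(b). [folklore] -/
theorem exists_pairMap_bijective (hc : ∀ k : ℕ, Nat.card (A[(p ^ k : ℕ)]) = p ^ (2 * k)) :
    ∃ a b : TateModule A p, Function.Bijective (pairMap a b) := by
  obtain ⟨P, hP, Q, hQ, hgen⟩ :=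
    exists_generators_of_card_torsionBy (A := A) (p := p) (by simpa using hc 1)
  have hs := exists_smul_eq_of_card_torsionBy hc
  obtain ⟨a, ha⟩ := exists_proj_one_eq (fun k P hP ↦ hs k hP) hP
  obtain ⟨b, hb⟩ := exists_proj_one_eq (fun k P hP ↦ hs k hP) hQ
  refine ⟨a, b, pairMap_bijective_of_levelMap_bijective a b (levelMap_bijective a b hc ?_)⟩
  rw [ha, hb]
  exact hgen

/-- The `ℤ_[p]`-linear isomorphism `ℤ_[p] × ℤ_[p] ≃ T_p A` under `#A[p^k] = p^{2k}` (a choice of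
`ℤ_p`-basis of `T_p A`). Silverman, *AEC*, Prop. III.7.1(a). [folklore] -/
def linearEquivProdOfCard (hc : ∀ k : ℕ, Nat.card (A[(p ^ k : ℕ)]) = p ^ (2 * k)) :
    (ℤ_[p] × ℤ_[p]) ≃ₗ[ℤ_[p]] TateModule A p :=
  LinearEquiv.ofBijective
    (pairMap (exists_pairMap_bijective hc).choose (exists_pairMap_bijective hc).choose_spec.choose)
    (exists_pairMap_bijective hc).choose_spec.choose_spec

/-- If `#A[p^k] = p^{2k}` for every `k`, then `T_p A` is a free `ℤ_p`-module.
Silverman, *AEC*, Prop. III.7.1(a). [folklore] -/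
theorem free_of_card_torsionBy (hc : ∀ k : ℕ, Nat.card (A[(p ^ k : ℕ)]) = p ^ (2 * k)) :
    Module.Free ℤ_[p] (TateModule A p) := by
  obtain ⟨a, b, hab⟩ := exists_pairMap_bijective hc
  exact Module.Free.of_equiv (LinearEquiv.ofBijective (pairMap a b) hab)

/-- If `#A[p^k] = p^{2k}` for every `k`, then `T_p A` is a finitely generated `ℤ_p`-module.
Silverman, *AEC*, Prop. III.7.1(a). [folklore] -/
theorem finite_of_card_torsionBy (hc : ∀ k : ℕ, Nat.card (A[(p ^ k : ℕ)]) = p ^ (2 * k)) :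
    Module.Finite ℤ_[p] (TateModule A p) := by
  obtain ⟨a, b, hab⟩ := exists_pairMap_bijective hc
  exact Module.Finite.equiv (LinearEquiv.ofBijective (pairMap a b) hab)

/-- If `#A[p^k] = p^{2k}` for every `k`, then `rank_{ℤ_p} T_p A = 2`.
Silverman, *AEC*, Prop. III.7.1(a) (from Cor. III.6.4(b)). [folklore] -/
theorem finrank_eq_two_of_card_torsionBy (hc : ∀ k : ℕ, Nat.card (A[(p ^ k : ℕ)]) = p ^ (2 * k)) :
    Module.finrank ℤ_[p] (TateModule A p) = 2 := by
  obtain ⟨a, b, hab⟩ := exists_pairMap_bijective hc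
  rw [← (LinearEquiv.ofBijective (pairMap a b) hab).finrank_eq, Module.finrank_prod,
    Module.finrank_self]

end Rank

end TateModule

/-! ### The rational Tate module `V_p A = ℚ_p ⊗ T_p A` -/

namespace RationalTateModule

variable {A : Type u} [AddCommGroup A] {p : ℕ} [Fact p.Prime]

/-- If `#A[p^k] = p^{2k}` for every `k`, then `dim_{ℚ_p} V_p A = 2` (base change of
`TateModule.finrank_eq_two_of_card_torsionBy`, Mathlib `Module.finrank_baseChange`).
Silverman, *AEC*, Prop. III.7.1 and Remark 7.2. [folklore] -/
theorem finrank_eq_two_of_card_torsionBy (hc : ∀ k : ℕ, Nat.card (A[(p ^ k : ℕ)]) = p ^ (2 * k)) :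
    Module.finrank ℚ_[p] (RationalTateModule A p) = 2 := by
  haveI := TateModule.free_of_card_torsionBy hc
  change Module.finrank ℚ_[p] (ℚ_[p] ⊗[ℤ_[p]] TateModule A p) = 2
  rw [Module.finrank_baseChange, TateModule.finrank_eq_two_of_card_torsionBy hc]

/-- If `#A[p^k] = p^{2k}` for every `k`, then `V_p A` is a finite-dimensional `ℚ_p`-vector space.
Silverman, *AEC*, Prop. III.7.1 and Remark 7.2. [folklore] -/
theorem finite_of_card_torsionBy (hc : ∀ k : ℕ, Nat.card (A[(p ^ k : ℕ)]) = p ^ (2 * k)) :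
    Module.Finite ℚ_[p] (RationalTateModule A p) := by
  haveI := TateModule.finite_of_card_torsionBy hc
  change Module.Finite ℚ_[p] (ℚ_[p] ⊗[ℤ_[p]] TateModule A p)
  infer_instance

end RationalTateModule

end Literature.NumberTheory.EllipticCurves

/-! ## The elliptic-curve statement: III.7.1(a) from III.6.4(b) -/

namespace WeierstrassCurve

open Literature.NumberTheory.EllipticCurves

variable {F : Type u} [Field F] (W : WeierstrassCurve F) (p : ℕ)

/-- For `p ≠ char F`, `#E(F̄)[p^k] = p^{2k}` for all `k`, from the named fact
`card_torsionPoints_eq_sq` (Silverman, *AEC*, Cor. III.6.4(b)) over `F̄`. [cite: SilvermanAEC2009, Cor. III.6.4(b)] -/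
theorem card_geomTorsion_pow_eq [W.IsElliptic] (h : card_torsionPoints_eq_sq W (AlgebraicClosure F))
    (hp : (p : F) ≠ 0) (k : ℕ) :
    Nat.card (geomTorsion W (p ^ k : ℕ)) = p ^ (2 * k) := by
  have hpL : ((p ^ k : ℕ) : AlgebraicClosure F) ≠ 0 := by
    rw [Nat.cast_pow]
    refine pow_ne_zero _ fun h0 ↦ hp ?_
    apply (algebraMap F (AlgebraicClosure F)).injective
    rw [map_natCast, map_zero, h0]
  have := h hpL
  rw [← pow_mul, Nat.mul_comm] at this
  exact this

variable [Fact p.Prime]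

/-- **Silverman, *AEC*, Prop. III.7.1(a) from Cor. III.6.4(b).** The named fact
`finrank_tateModule_eq_two W p` (`rank_{ℤ_p} T_p E = 2` for `p ≠ char F`) follows from the named
fact `card_torsionPoints_eq_sq W F̄` (`#E(F̄)[m] = m²` for `m ≠ 0` in `F̄`), by the printed proof:
`#E[p^k] = p^{2k}` for all `k` forces `E[p^k] ≅ (ℤ/p^k)²` compatibly and `T_p E ≅ ℤ_p²`
(`Literature.NumberTheory.EllipticCurves.TateModule.finrank_eq_two_of_card_torsionBy`). [cite: SilvermanAEC2009, Prop. III.7.1(a)] -/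
theorem finrank_tateModule_eq_two_of_card_torsionPoints_eq_sq
    (h : card_torsionPoints_eq_sq W (AlgebraicClosure F)) : finrank_tateModule_eq_two W p := by
  intro _ hp
  exact TateModule.finrank_eq_two_of_card_torsionBy (card_geomTorsion_pow_eq W p h hp)

/-- Under `card_torsionPoints_eq_sq W F̄` and `p ≠ char F`, `T_p E` is a free `ℤ_p`-module.
Silverman, *AEC*, Prop. III.7.1(a). [cite: SilvermanAEC2009, Prop. III.7.1(a)] -/
theorem free_tateModule_of_card_torsionPoints_eq_sq [W.IsElliptic]
    (h : card_torsionPoints_eq_sq W (AlgebraicClosure F)) (hp : (p : F) ≠ 0) :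
    Module.Free ℤ_[p] (W.tateModule p) :=
  TateModule.free_of_card_torsionBy (card_geomTorsion_pow_eq W p h hp)

/-- Under `card_torsionPoints_eq_sq W F̄` and `p ≠ char F`, `T_p E` is a finitely generated
`ℤ_p`-module. Silverman, *AEC*, Prop. III.7.1(a). [cite: SilvermanAEC2009, Prop. III.7.1(a)] -/
theorem finite_tateModule_of_card_torsionPoints_eq_sq [W.IsElliptic]
    (h : card_torsionPoints_eq_sq W (AlgebraicClosure F)) (hp : (p : F) ≠ 0) :
    Module.Finite ℤ_[p] (W.tateModule p) :=
  TateModule.finite_of_card_torsionBy (card_geomTorsion_pow_eq W p h hp)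

/-- **Silverman, *AEC*, Prop. III.7.1(a) for `V_p` (Remark 7.2), from Cor. III.6.4(b).** The named fact
`finrank_rationalTateModule_eq_two W p` (`dim_{ℚ_p} V_p E = 2` for `p ≠ char F`) follows from
`card_torsionPoints_eq_sq W F̄`. [cite: SilvermanAEC2009, Prop. III.7.1 with Remark 7.2] -/
theorem finrank_rationalTateModule_eq_two_of_card_torsionPoints_eq_sq
    (h : card_torsionPoints_eq_sq W (AlgebraicClosure F)) :
    finrank_rationalTateModule_eq_two W p := by
  intro _ hp
  exact RationalTateModule.finrank_eq_two_of_card_torsionBy (card_geomTorsion_pow_eq W p h hp)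

/-- Under `card_torsionPoints_eq_sq W F̄` and `p ≠ char F`, `V_p E` is finite-dimensional over
`ℚ_p`. Silverman, *AEC*, Prop. III.7.1. [cite: SilvermanAEC2009, Prop. III.7.1 with Remark 7.2] -/
theorem finite_rationalTateModule_of_card_torsionPoints_eq_sq [W.IsElliptic]
    (h : card_torsionPoints_eq_sq W (AlgebraicClosure F)) (hp : (p : F) ≠ 0) :
    Module.Finite ℚ_[p] (W.rationalTateModule p) :=
  RationalTateModule.finite_of_card_torsionBy (card_geomTorsion_pow_eq W p h hp)

end WeierstrassCurve
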